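import Literature.AnabelianGeometry.SemiGraphs.ProSigmaCuspInertiaDisjointTwo
import Literature.AnabelianGeometry.SemiGraphs.ProSigmaHeisenbergSeparation
import HarnessLib

/-!
# A lone cusp against the node and the opposite component: disjointness from Heisenberg quotients (two-component shapes with a ONE-marked-point component)

[SemiAnbd] Example 2.10 (p. 31) / [CombGC] Prop. 1.5 (i) p. 12 ("a cuspidal edge-like subgroup is contained
in precisely one verticial subgroup; a nodal one in precisely two") and Prop. 1.2 proof p. 9
[cite: MochizukiCombGC2007, Prop 1.5(i) p.12] [cite: MochizukiSemiAnbd2006, Ex. 2.10 p.31].  At the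
two-component one-node shapes of abc-iut-f-164 (`PSCTwoComponentAffineShape.lean`: `C₀ ∪_ν C₁` over a
pro-`Σ` completion `ι : Γ_{g,r} → Π`, node loop `ε = (c_s⋯c_{r−1})∏_{i<g₀}[a_i,b_i]`) the incidence facts
`Π_c ∩ x Π_ν x⁻¹ = 1`, `Π_c ∩ x Π_{v'} x⁻¹ = 1` (`c` a cusp of `v ≠ v'`) were obtained from free-factor
disjointness, which needs `c` to sit in a common free basis with `ε` resp. with the generators of `Π_{v'}` —
available for `s ≥ 2`, `r − s ≥ 2` (gen 3), NOT for a component carrying a SINGLE marked point (`s = 1`: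
`c_0 = (∏_{i≥g₀}[a_i,b_i])⁻¹ ε⁻¹`; `r − s = 1`: `c_{r−1}`), gen 3's resume point (ii)/(iii).

PROOF-ONLY file (abc-iut-f-164 gen 4): the LONE-CUSP disjointness facts from NON-ABELIAN finite quotients,
by abc-iut-w5-d051's quotient engine (`closure_zpowers_inf_conj_eq_bot_of_quotients`, generalised here to a
killed SUBGROUP) fed with gen 2's Heisenberg homomorphisms (`exists_hom_handle_cusp`: one active handle
`(a_{i₀}, b_{i₀}) ↦ (X, Y)` on the lone cusp's OWN component, the lone cusp `↦ [X,Y]⁻¹`, everything else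
`↦ 1`; in the Heisenberg group of order `n³` the commutator has order exactly `n`):

* `closure_map_inf_conj_zpowers_eq_bot_of_quotients` — the engine with a killed subgroup `H ≤ Γ`:
  `cl ι(H) ∩ x · cl ι⟨c'⟩ · x⁻¹ = 1` as soon as every `Σ`-integer `n` admits a finite `Σ`-quotient killing
  `H` in which every power `φ(c')^k = 1` has `n ∣ k`;
* `loneCuspZero_vertex_inf_conj_eq_bot`, `loneCuspZero_nodeLoop_inf_conj_eq_bot` — `s = 1`: the
  generators of `Π_{v₀}` (handles `i < g₀`, cusps `j ≥ 1`) resp. the node loop `ε` against `c_0`, given a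
  handle `i₀ ≥ g₀` on `C₁`;
* `loneCuspLast_vertex_inf_conj_eq_bot`, `loneCuspLast_nodeLoop_inf_conj_eq_bot` — `s = r − 1`: the
  generators of `Π_{v₁}` (handles `i ≥ g₀`, cusps `j < r − 1`, `ε`) resp. `ε` against `c_{r−1}`, given a
  handle `i₀ < g₀` on `C₀`.

Inputs for [CombGC] Prop. 1.5 (i) at one-marked-point components; classical (pro)finite group theory;
nothing here takes a side on [IUTchIII] Cor. 3.12.
-/

noncomputable section

namespace Literature.AnabelianGeometry.SemiGraphs.SemiGraphOfAnabelioids.IsProSigmaCompletion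

open Literature.AnabelianGeometry.Anabelioids (IsSigmaInteger)
open Literature.GroupTheory.CombinatorialGroupTheory
open Literature.GroupTheory.CombinatorialGroupTheory.PuncturedSurfaceGroup (a b c exists_hom_handle_cusp
  hom_handle_cusp_nodeLoop)
open scoped Pointwise

universe v

section Engine

variable {Sigma : Set ℕ} {Γ : Type*} [Group Γ] {P : Type v} [Group P] [TopologicalSpace P]
  [IsTopologicalGroup P] [CompactSpace P] [TotallyDisconnectedSpace P] {ι : Γ →* P}

/-- **Disjointness of `cl ι(H)` from a closed procyclic subgroup, from finite quotients killing `H`.**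
Let `ι : Γ → P` be a pro-`Σ` completion (`P` profinite), `H ≤ Γ`, `c' ∈ Γ`.  Suppose that for every
`Σ`-integer `n` there is a homomorphism `φ : Γ → G` to a finite group of `Σ`-integer order with `H ≤ Ker φ`
and such that every power `φ(c')^k = 1` has `n ∣ k`.  Then `cl ι(H) ∩ x · cl ι⟨c'⟩ · x⁻¹ = 1` for every
`x ∈ P` (as `closure_zpowers_inf_conj_eq_bot_of_quotients`, with `cl ι⟨c⟩` replaced by `cl ι(H)`).
[cite: MochizukiSemiAnbd2006, Ex. 2.10 p.31] -/
theorem closure_map_inf_conj_zpowers_eq_bot_of_quotients (hι : IsProSigmaCompletion Sigma ι)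
    (H : Subgroup Γ) (c' : Γ)
    (hφ : ∀ n : ℕ, IsSigmaInteger Sigma n →
      ∃ (G : Type) (_ : Group G) (_ : Finite G) (φ : Γ →* G),
        IsSigmaInteger Sigma (Nat.card G) ∧ H ≤ φ.ker ∧ ∀ k : ℕ, φ c' ^ k = 1 → n ∣ k)
    (x : P) :
    (H.map ι).topologicalClosure ⊓
      ConjAct.toConjAct x • (Subgroup.zpowers (ι c')).topologicalClosure = ⊥ := by
  classical
  rw [eq_bot_iff]
  rintro y ⟨hyI, hyJ⟩
  rw [Subgroup.mem_bot]
  by_contra hy1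
  -- an open normal `N₀` missing `y`, of `Σ`-index `n`
  obtain ⟨N₀, hN₀⟩ := ProfiniteGrp.exist_openNormalSubgroup_sub_open_nhds_of_one
    (isOpen_compl_singleton (x := y)) (show (1 : P) ∈ ({y}ᶜ : Set P) from fun h => hy1 h.symm)
  have hyN₀ : y ∉ (N₀ : Subgroup P) := fun h => hN₀ h rfl
  haveI : (N₀ : Subgroup P).Normal := N₀.isNormal'
  obtain ⟨n, hndef⟩ : ∃ n, n = (N₀ : Subgroup P).index := ⟨_, rfl⟩
  have hn : IsSigmaInteger Sigma n := hndef ▸ hι.index_open _ N₀.isNormal' N₀.isOpen'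
  -- the finite quotient at this level, extended to `P`
  obtain ⟨G, _, _, φ, hG, hH, hc'⟩ := hφ n hn
  letI : TopologicalSpace G := ⊥
  haveI : DiscreteTopology G := ⟨rfl⟩
  obtain ⟨χ, hχc, hχ⟩ := hι.exists_continuous_extend_top hG φ
  -- the level `K = N₀ ∩ Ker χ`
  have hk₁ : IsOpen (χ.ker : Set P) := (isOpen_discrete ({1} : Set _)).preimage hχc
  let Kχ : OpenNormalSubgroup P := { toSubgroup := χ.ker, isOpen' := hk₁ }
  let K : OpenNormalSubgroup P := N₀ ⊓ Kχ
  have hKle₀ : (K : Subgroup P) ≤ (N₀ : Subgroup P) := fun z hz => hz.1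
  have hKleχ : (K : Subgroup P) ≤ χ.ker := fun z hz => hz.2
  haveI : (K : Subgroup P).Normal := K.isNormal'
  -- `y ∈ ι(H) · K`
  have hyI' := topologicalClosure_le_sup_of_isOpen _ (K : Subgroup P) K.isOpen' hyI
  rw [← SetLike.mem_coe, Subgroup.mul_normal] at hyI'
  obtain ⟨s, hs, k₁, hk₁K, hy⟩ := hyI'
  rw [SetLike.mem_coe] at hs
  obtain ⟨h, hh, rfl⟩ := Subgroup.mem_map.mp hs
  -- `y ∈ x · (ι⟨c'⟩ · K) · x⁻¹`
  obtain ⟨y', hy', hxy⟩ := (Subgroup.mem_smul_pointwise_iff_exists _ _ _).mp hyJ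
  have hyJ' := topologicalClosure_le_sup_of_isOpen _ (K : Subgroup P) K.isOpen' hy'
  rw [← SetLike.mem_coe, Subgroup.mul_normal] at hyJ'
  obtain ⟨t, ht, k₂, hk₂K, hy''⟩ := hyJ'
  rw [SetLike.mem_coe] at ht
  obtain ⟨τ, rfl⟩ := Subgroup.mem_zpowers_iff.mp ht
  -- evaluate `χ` on `y` both ways
  have e1 : χ y = 1 := by
    rw [← hy, map_mul, (hKleχ hk₁K : χ k₁ = 1), mul_one, hχ]
    exact hH hh
  have e2 : χ y = χ x * φ c' ^ τ * (χ x)⁻¹ := by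
    rw [← hxy, ConjAct.toConjAct_smul, map_mul, map_mul, ← hy'', map_mul,
      (hKleχ hk₂K : χ k₂ = 1), mul_one, map_zpow, hχ, map_inv]
  have hpow : φ c' ^ τ = 1 := by
    rw [e1] at e2
    have h := e2.symm
    rwa [mul_inv_eq_one, mul_eq_left] at h
  have hdvd : (n : ℤ) ∣ τ := by
    have h1 : (orderOf (φ c') : ℤ) ∣ τ := orderOf_dvd_iff_zpow_eq_one.mpr hpow
    have h2 : n ∣ orderOf (φ c') := hc' _ (pow_orderOf_eq_one (φ c'))
    exact (Int.natCast_dvd_natCast.mpr h2).trans h1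
  -- hence `ι(c')^τ ∈ N₀` and `y ∈ N₀`
  obtain ⟨d, hd⟩ := hdvd
  have hτn : ι c' ^ (n : ℤ) ∈ (N₀ : Subgroup P) := by
    rw [zpow_natCast, hndef]
    exact Subgroup.pow_index_mem _ _
  have hτs : ι c' ^ τ ∈ (N₀ : Subgroup P) := by
    rw [hd, zpow_mul]
    exact Subgroup.zpow_mem _ hτn d
  have hy'N : y' ∈ (N₀ : Subgroup P) := hy'' ▸ (N₀ : Subgroup P).mul_mem hτs (hKle₀ hk₂K)
  apply hyN₀
  rw [← hxy, ConjAct.toConjAct_smul]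
  exact (N₀.isNormal').conj_mem _ hy'N x

end Engine

/-! ### The Heisenberg quotient seeing a lone cusp -/

section LoneCusp

variable {Sigma : Set ℕ} {g r : ℕ} {P : Type v} [Group P] [TopologicalSpace P]
  [IsTopologicalGroup P] [CompactSpace P] [TotallyDisconnectedSpace P] {ι : PuncturedSurfaceGroup g r →* P}

/-- **The Heisenberg quotient of a lone cusp.**  For a handle `i₀`, a cusp `j₀` and a `Σ`-integer `n`:
a homomorphism `ψ : Γ_{g,r} → G` onto-ish a finite group of order `n³` (a `Σ`-integer) with
`(a_{i₀}, b_{i₀}) ↦ (X, Y)`, `c_{j₀} ↦ [X,Y]⁻¹` of order exactly `n`, all other generators `↦ 1`.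
[cite: MochizukiSemiAnbd2006, Ex. 2.10 p.31] -/
theorem exists_heisenberg_hom_loneCusp (i₀ : Fin g) (j₀ : Fin r) {n : ℕ} (hn : IsSigmaInteger Sigma n) :
    ∃ (G : Type) (_ : Group G) (_ : Finite G) (ψ : PuncturedSurfaceGroup g r →* G) (X Y : G),
      IsSigmaInteger Sigma (Nat.card G) ∧ ψ (a i₀) = X ∧ ψ (b i₀) = Y ∧
      ψ (c j₀) = (X * Y * X⁻¹ * Y⁻¹)⁻¹ ∧ (∀ i, i ≠ i₀ → ψ (a i) = 1 ∧ ψ (b i) = 1) ∧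
      (∀ j, j ≠ j₀ → ψ (c j) = 1) ∧ ∀ k : ℕ, ψ (c j₀) ^ k = 1 → n ∣ k := by
  obtain ⟨φH, X, Y, Z, hXYZ, hZ, hcard⟩ := Heisenberg.exists_heisenbergTriple n
  obtain ⟨ψ, ha, hb, hc, hab, hc'⟩ := exists_hom_handle_cusp (g := g) (r := r) i₀ j₀ X Y Z⁻¹
    (by rw [hXYZ, mul_inv_cancel])
  have hG : IsSigmaInteger Sigma (Nat.card (Multiplicative (ZMod n × ZMod n) ⋊[φH] Multiplicative (ZMod n))) := by
    rw [hcard, pow_succ, pow_two]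
    exact (hn.mul hn).mul hn
  haveI : Finite (Multiplicative (ZMod n × ZMod n) ⋊[φH] Multiplicative (ZMod n)) :=
    Nat.finite_of_card_ne_zero (by rw [hcard]; exact (pow_pos hn.1 3).ne')
  refine ⟨_, inferInstance, inferInstance, ψ, X, Y, hG, ha, hb, by rw [hc, hXYZ], hab, hc', fun k hk => ?_⟩
  rw [hc, inv_pow, inv_eq_one] at hk
  exact (hZ k).mp hk

/-- **`s = 1` (the component `C₁` carries the single marked point `c_0`): `Π_{v₀}` against `Π_{c_0}`.**  For a
handle `i₀ ≥ g₀` (on `C₁`) and every `x`: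
`cl ι⟨a_i, b_i (i<g₀), c_j (j ≥ 1)⟩ ∩ x · cl ι⟨c_0⟩ · x⁻¹ = 1`. [cite: MochizukiCombGC2007, Prop 1.5(i) p.12] -/
theorem loneCuspZero_vertex_inf_conj_eq_bot (hι : IsProSigmaCompletion Sigma ι) {g₀ : ℕ} (i₀ : Fin g)
    (hi₀ : g₀ ≤ (i₀ : ℕ)) (hr : 0 < r) (x : P) :
    ((Subgroup.closure {y : PuncturedSurfaceGroup g r |
        (∃ i : Fin g, (i : ℕ) < g₀ ∧ (y = a i ∨ y = b i)) ∨
          ∃ j : Fin r, 1 ≤ (j : ℕ) ∧ y = c j}).map ι).topologicalClosure ⊓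
      ConjAct.toConjAct x • ((Subgroup.zpowers (c (g := g) (⟨0, hr⟩ : Fin r))).map ι).topologicalClosure = ⊥ := by
  rw [MonoidHom.map_zpowers]
  refine closure_map_inf_conj_zpowers_eq_bot_of_quotients hι _ _ (fun n hn => ?_) x
  obtain ⟨G, _, _, ψ, X, Y, hG, -, -, -, hab, hc', hk⟩ := exists_heisenberg_hom_loneCusp (g := g) (r := r)
    i₀ ⟨0, hr⟩ hn
  refine ⟨G, inferInstance, inferInstance, ψ, hG, (Subgroup.closure_le _).mpr ?_, hk⟩
  rintro y (⟨i, hi, rfl | rfl⟩ | ⟨j, hj, rfl⟩)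
  · exact (hab i (fun h => by subst h; omega)).1
  · exact (hab i (fun h => by subst h; omega)).2
  · exact hc' j (fun h => by subst h; simp at hj)

/-- **`s = 1`: the node loop against `Π_{c_0}`.**  With `ε = (c_1⋯c_{r−1})∏_{i<g₀}[a_i,b_i]`, a handle
`i₀ ≥ g₀` and every `x`: `cl ι⟨ε⟩ ∩ x · cl ι⟨c_0⟩ · x⁻¹ = 1`. [cite: MochizukiCombGC2007, Prop 1.5(i) p.12] -/
theorem loneCuspZero_nodeLoop_inf_conj_eq_bot (hι : IsProSigmaCompletion Sigma ι) {g₀ : ℕ} (i₀ : Fin g)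
    (hi₀ : g₀ ≤ (i₀ : ℕ)) (hr : 0 < r) (ε : PuncturedSurfaceGroup g r)
    (hε : ε = ((List.finRange r).map fun j : Fin r =>
          if 1 ≤ (j : ℕ) then c (g := g) j else 1).prod *
        ((List.finRange g).map fun i : Fin g => if (i : ℕ) < g₀ then
          a (r := r) i * b i * (a i)⁻¹ * (b i)⁻¹ else 1).prod) (x : P) :
    ((Subgroup.zpowers ε).map ι).topologicalClosure ⊓
      ConjAct.toConjAct x • ((Subgroup.zpowers (c (g := g) (⟨0, hr⟩ : Fin r))).map ι).topologicalClosure = ⊥ := by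
  rw [MonoidHom.map_zpowers (f := ι) (c (g := g) (⟨0, hr⟩ : Fin r))]
  refine closure_map_inf_conj_zpowers_eq_bot_of_quotients hι _ _ (fun n hn => ?_) x
  obtain ⟨G, _, _, ψ, X, Y, hG, ha, hb, hc, hab, hc', hk⟩ := exists_heisenberg_hom_loneCusp (g := g) (r := r)
    i₀ ⟨0, hr⟩ hn
  refine ⟨G, inferInstance, inferInstance, ψ, hG, ?_, hk⟩
  rw [Subgroup.zpowers_le, MonoidHom.mem_ker, hε, hom_handle_cusp_nodeLoop ψ ha hb hc hab hc' g₀ 1,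
    if_neg (show ¬ (1 ≤ ((⟨0, hr⟩ : Fin r) : ℕ)) by simp), if_neg (show ¬ ((i₀ : ℕ) < g₀) by omega),
    mul_one]

/-- **`s = r − 1` (the component `C₀` carries the single marked point `c_{r−1}`): `Π_{v₁}` against
`Π_{c_{r−1}}`.**  With `ε = c_{r−1} ∏_{i<g₀}[a_i,b_i]`, a handle `i₀ < g₀` (on `C₀`) and every `x`:
`cl ι⟨a_i, b_i (i ≥ g₀), c_j (j < r−1), ε⟩ ∩ x · cl ι⟨c_{r−1}⟩ · x⁻¹ = 1`.
[cite: MochizukiCombGC2007, Prop 1.5(i) p.12] -/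
theorem loneCuspLast_vertex_inf_conj_eq_bot (hι : IsProSigmaCompletion Sigma ι) {g₀ : ℕ} (i₀ : Fin g)
    (hi₀ : (i₀ : ℕ) < g₀) (hr : 0 < r) (ε : PuncturedSurfaceGroup g r)
    (hε : ε = ((List.finRange r).map fun j : Fin r =>
          if r - 1 ≤ (j : ℕ) then c (g := g) j else 1).prod *
        ((List.finRange g).map fun i : Fin g => if (i : ℕ) < g₀ then
          a (r := r) i * b i * (a i)⁻¹ * (b i)⁻¹ else 1).prod) (x : P) :
    ((Subgroup.closure {y : PuncturedSurfaceGroup g r |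
        (∃ i : Fin g, g₀ ≤ (i : ℕ) ∧ (y = a i ∨ y = b i)) ∨
          (∃ j : Fin r, (j : ℕ) < r - 1 ∧ y = c j) ∨ y = ε}).map ι).topologicalClosure ⊓
      ConjAct.toConjAct x •
        ((Subgroup.zpowers (c (g := g) (⟨r - 1, by omega⟩ : Fin r))).map ι).topologicalClosure = ⊥ := by
  rw [MonoidHom.map_zpowers (f := ι) (c (g := g) (⟨r - 1, by omega⟩ : Fin r))]
  refine closure_map_inf_conj_zpowers_eq_bot_of_quotients hι _ _ (fun n hn => ?_) x
  obtain ⟨G, _, _, ψ, X, Y, hG, ha, hb, hc, hab, hc', hk⟩ := exists_heisenberg_hom_loneCusp (g := g) (r := r)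
    i₀ ⟨r - 1, by omega⟩ hn
  have hψε : ψ ε = 1 := by
    rw [hε, hom_handle_cusp_nodeLoop ψ ha hb hc hab hc' g₀ (r - 1),
      if_pos (show r - 1 ≤ ((⟨r - 1, _⟩ : Fin r) : ℕ) from le_rfl), if_pos hi₀, inv_mul_cancel]
  refine ⟨G, inferInstance, inferInstance, ψ, hG, (Subgroup.closure_le _).mpr ?_, hk⟩
  rintro y (⟨i, hi, rfl | rfl⟩ | ⟨j, hj, rfl⟩ | rfl)
  · exact (hab i (fun h => by subst h; omega)).1
  · exact (hab i (fun h => by subst h; omega)).2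
  · exact hc' j (fun h => by subst h; simp at hj)
  · exact hψε

/-- **`s = r − 1`: the node loop against `Π_{c_{r−1}}`.**  With `ε = c_{r−1} ∏_{i<g₀}[a_i,b_i]`, a handle
`i₀ < g₀` and every `x`: `cl ι⟨ε⟩ ∩ x · cl ι⟨c_{r−1}⟩ · x⁻¹ = 1`. [cite: MochizukiCombGC2007, Prop 1.5(i) p.12] -/
theorem loneCuspLast_nodeLoop_inf_conj_eq_bot (hι : IsProSigmaCompletion Sigma ι) {g₀ : ℕ} (i₀ : Fin g)
    (hi₀ : (i₀ : ℕ) < g₀) (hr : 0 < r) (ε : PuncturedSurfaceGroup g r)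
    (hε : ε = ((List.finRange r).map fun j : Fin r =>
          if r - 1 ≤ (j : ℕ) then c (g := g) j else 1).prod *
        ((List.finRange g).map fun i : Fin g => if (i : ℕ) < g₀ then
          a (r := r) i * b i * (a i)⁻¹ * (b i)⁻¹ else 1).prod) (x : P) :
    ((Subgroup.zpowers ε).map ι).topologicalClosure ⊓
      ConjAct.toConjAct x •
        ((Subgroup.zpowers (c (g := g) (⟨r - 1, by omega⟩ : Fin r))).map ι).topologicalClosure = ⊥ := by
  rw [MonoidHom.map_zpowers (f := ι) (c (g := g) (⟨r - 1, by omega⟩ : Fin r))]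
  refine closure_map_inf_conj_zpowers_eq_bot_of_quotients hι _ _ (fun n hn => ?_) x
  obtain ⟨G, _, _, ψ, X, Y, hG, ha, hb, hc, hab, hc', hk⟩ := exists_heisenberg_hom_loneCusp (g := g) (r := r)
    i₀ ⟨r - 1, by omega⟩ hn
  refine ⟨G, inferInstance, inferInstance, ψ, hG, ?_, hk⟩
  rw [Subgroup.zpowers_le, MonoidHom.mem_ker, hε, hom_handle_cusp_nodeLoop ψ ha hb hc hab hc' g₀ (r - 1),
    if_pos (show r - 1 ≤ ((⟨r - 1, _⟩ : Fin r) : ℕ) from le_rfl), if_pos hi₀, inv_mul_cancel]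

end LoneCusp

end Literature.AnabelianGeometry.SemiGraphs.SemiGraphOfAnabelioids.IsProSigmaCompletion

end
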